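import Mathlib
import Summits.ValiantsHypothesis.ValiantsHypothesis.Theorems.NewtonUnitEquationsDissociatedUniformQuasiPoly
import Summits.ValiantsHypothesis.ValiantsHypothesis.Theorems.NewtonUnitEquationsDissociatedUniformTorusLogKCell

/-!
# Crux `NewtonUnitEquations.DissociatedUniform` (stmt-ValiantsHypothesis-5905), line `greedy-basis-shadow` —
# stub `stub_zerosCrossNovelty` (all frames, zeros allowed: the doubled vector of a demotion of a greedy word is
# span-novel among the doubled vectors of the lighter admissible demotions)

Setting: a frame `A : Fin m → Finset ℕ²` with coefficient polynomials `f i j` (coefficients of alphabet letters MAY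
vanish), the chart height `h b = ε · Xf b + λ · Yf b`, a reference word `τ` with letters in the alphabet (`hτA`), and a
word `a` that is lex-greedy for `h` (`a ∈ QuasiPoly.gE (piFinset A) (col f) h`: `col f a` is not in the span of the
columns of the strictly higher box words), with `a j ≠ τ j`.  A DEMOTION is a pair `d = (j', l')` (coordinate,
letter).  Its DOUBLED vector `W d : Fin 2 × Fin k → ℂ` has first block `W d (0, i) = coeff l' / coeff (τ j')`
(coefficients of `f i j'`; this is `0` where `coeff (τ j') = 0`, as `x / 0 = 0`) and second block
`W d (1, i) = coeff l'` if `coeff (τ j') = 0` and `0` otherwise.  Claim: `W (j, a j)` is not in the span of the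
`W d'`, `d' = (j', l')` admissible: `l' ∈ A j'`, `l' ≠ τ j'`, strictly lighter
(`η (τ j') - η l' < η (τ j) - η (a j)` for the letter height `η l = ε · l 0 + λ · l 1`), and either `j' = j`, or
`a j' = τ j'` and no product kills the reset word `a' := update a j (τ j)` exactly at `j'`.

Proof.  Take a finite relation `W (j, a j) = Σ_{d'} β_{d'} W d'` supported on admissible `d'`.  Every admissible
`d' = (j', l')` has `a' j' = τ j'` and names the box word `update a' j' l'`, which is strictly higher than `a`
(heights are additive over letters, `TorusLogK.hgt_update`).  We show, product by product,
`col f a i = Σ β_{d'} · col f (update a' j' l') i` (★), whence `col f a` lies in the span of strictly higher box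
columns — contradicting greediness.  Write `c_{j'}(l)` for the coefficient of `l` in `f i j'` and `R` for the
product of the `c_{j''}(a j'')`, `j'' ≠ j`, so `col f a i = c_j(a j) · R` and `col f a' i = c_j(τ j) · R`.
* If `c_j(τ j) ≠ 0`, read the relation at `(0, i)` and multiply by `col f a' i`: the left side becomes `col f a i`;
  a term with `c_{j'}(τ j') ≠ 0` becomes `β · col f (update a' j' l') i` (split the product at `j'`); a term with
  `c_{j'}(τ j') = 0` (then `j' ≠ j`) has `W d' (0, i) = 0`, and also `col f (update a' j' l') i = 0`, for otherwise
  product `i` would kill `a'` exactly at `j'`, which admissibility forbids.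
* If `c_j(τ j) = 0`, read the relation at `(1, i)` (left side `c_j(a j)`) and multiply by `R`: a term on `j` gives
  `β · c_j(l') · R = β · col f (update a j l') i`; a term on `j' ≠ j` vanishes on both sides — `W d' (1, i) · R = 0`
  because either `W d' (1, i) = 0` or `c_{j'}(τ j') = 0` is a factor of `R` (`a j' = τ j'`), and
  `col f (update a' j' l') i = 0` because that word carries the dead letter `τ j` at `j`.
[folklore]
-/

open scoped BigOperators

-- Sub = Summit single-conjunct layout: the duplicated namespace component is mandated by the tree.
set_option linter.dupNamespace false

namespace Summit.ValiantsHypothesis.ValiantsHypothesis.Theorems.NewtonUnitEquationsDissociatedUniform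

/-- Splitting a Khatri–Rao column entry at a coordinate `j₀`: the entry is the coefficient of the letter at `j₀`
times the product of the coefficients of the other letters. -/
private theorem zcn_col_split {k m : ℕ} (f : Fin k → Fin m → MvPolynomial (Fin 2) ℂ)
    (c : Fin m → (Fin 2 →₀ ℕ)) (j₀ : Fin m) (i : Fin k) :
    QuasiPoly.col f c i = (f i j₀).coeff (c j₀) * ∏ x ∈ Finset.univ.erase j₀, (f i x).coeff (c x) := by
  unfold QuasiPoly.col
  rw [← Finset.mul_prod_erase Finset.univ (fun x => (f i x).coeff (c x)) (Finset.mem_univ j₀)]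

/-- Splitting the column entry of an updated word at the updated coordinate: the new coefficient times the product
of the coefficients of the untouched letters. -/
private theorem zcn_col_update_split {k m : ℕ} (f : Fin k → Fin m → MvPolynomial (Fin 2) ℂ)
    (c : Fin m → (Fin 2 →₀ ℕ)) (j₀ : Fin m) (l₀ : Fin 2 →₀ ℕ) (i : Fin k) :
    QuasiPoly.col f (Function.update c j₀ l₀) i =
      (f i j₀).coeff l₀ * ∏ x ∈ Finset.univ.erase j₀, (f i x).coeff (c x) := by
  rw [zcn_col_split f (Function.update c j₀ l₀) j₀ i, Function.update_self]
  congr 1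
  exact Finset.prod_congr rfl fun x hx => by rw [Function.update_of_ne (Finset.ne_of_mem_erase hx)]

/-- A word carrying a dead letter (zero coefficient in product `i`) has zero column entry in product `i`. -/
private theorem zcn_col_eq_zero {k m : ℕ} (f : Fin k → Fin m → MvPolynomial (Fin 2) ℂ)
    (c : Fin m → (Fin 2 →₀ ℕ)) (x : Fin m) (i : Fin k) (h : (f i x).coeff (c x) = 0) :
    QuasiPoly.col f c i = 0 := by
  unfold QuasiPoly.col
  exact Finset.prod_eq_zero (Finset.mem_univ x) h

/-- **Cross novelty with zeros** (registered stub `stub_zerosCrossNovelty` of line `greedy-basis-shadow`).  For every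
frame, every reference word `τ` of the box, every lex-greedy word `a` for the chart height `b ↦ ε · Xf b + λ · Yf b`
and every coordinate `j` with `a j ≠ τ j`: the doubled coefficient vector of the demotion `(j, a j)` (first block the
ratios `coeff (a j) / coeff (τ j)`, second block the raw coefficients `coeff (a j)` on the products where
`coeff (τ j) = 0`) is not in the span of the doubled vectors of the lighter admissible demotions `(j', l')`
(`l' ∈ A j'`, `l' ≠ τ j'`, strictly smaller weight, and `j' = j` or: `a j' = τ j'` and no product kills
`update a j (τ j)` exactly at `j'`): a relation would reassemble `col f a`, product by product, as a combination of
the columns of the strictly higher box words `update (update a j (τ j)) j' l'`. [folklore] -/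
theorem stub_zerosCrossNovelty (k m : ℕ) (A : Fin m → Finset (Fin 2 →₀ ℕ))
    (f : Fin k → Fin m → MvPolynomial (Fin 2) ℂ) (ε lam : ℝ) (τ a : Fin m → (Fin 2 →₀ ℕ)) (j : Fin m)
    (hτA : ∀ j, τ j ∈ A j)
    (ha : a ∈ QuasiPoly.gE (Fintype.piFinset A) (QuasiPoly.col f)
      (fun b : Fin m → (Fin 2 →₀ ℕ) => ε * QuasiPoly.Xf b + lam * QuasiPoly.Yf b))
    (hj : a j ≠ τ j) :
    (fun p : Fin 2 × Fin k => if p.1 = 0 then (f p.2 j).coeff (a j) / (f p.2 j).coeff (τ j)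
        else (if (f p.2 j).coeff (τ j) = 0 then (f p.2 j).coeff (a j) else 0)) ∉
      Submodule.span ℂ ((fun d : Fin m × (Fin 2 →₀ ℕ) => fun p : Fin 2 × Fin k =>
          if p.1 = 0 then (f p.2 d.1).coeff d.2 / (f p.2 d.1).coeff (τ d.1)
          else (if (f p.2 d.1).coeff (τ d.1) = 0 then (f p.2 d.1).coeff d.2 else 0)) ''
        {d' : Fin m × (Fin 2 →₀ ℕ) | d'.2 ∈ A d'.1 ∧ d'.2 ≠ τ d'.1 ∧
          (ε * ((τ d'.1 0 : ℕ) : ℝ) + lam * ((τ d'.1 1 : ℕ) : ℝ)) - (ε * ((d'.2 0 : ℕ) : ℝ) + lam * ((d'.2 1 : ℕ) : ℝ)) <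
            (ε * ((τ j 0 : ℕ) : ℝ) + lam * ((τ j 1 : ℕ) : ℝ)) - (ε * ((a j 0 : ℕ) : ℝ) + lam * ((a j 1 : ℕ) : ℝ)) ∧
          (d'.1 = j ∨ (a d'.1 = τ d'.1 ∧ ¬ ∃ i' : Fin k, (f i' d'.1).coeff (τ d'.1) = 0 ∧
              ∀ j'', j'' ≠ d'.1 → (f i' j'').coeff (Function.update a j (τ j) j'') ≠ 0))}) := by
  classical
  intro hmem
  obtain ⟨haA, hnot⟩ := ha
  apply hnot
  -- a finite relation supported on admissible demotions
  obtain ⟨l, hl, hcomb⟩ := (Finsupp.mem_span_image_iff_linearCombination ℂ).1 hmem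
  have hlT := (Finsupp.mem_supported ℂ l).1 hl
  -- updating a box word by an alphabet letter stays in the box
  have hupdA : ∀ c : Fin m → (Fin 2 →₀ ℕ), c ∈ Fintype.piFinset A →
      ∀ (j₀ : Fin m) (l₀ : Fin 2 →₀ ℕ), l₀ ∈ A j₀ → Function.update c j₀ l₀ ∈ Fintype.piFinset A := by
    intro c hc j₀ l₀ hl₀
    rw [Fintype.mem_piFinset] at hc ⊢
    intro x
    rcases eq_or_ne x j₀ with rfl | hx
    · rw [Function.update_self]; exact hl₀
    · rw [Function.update_of_ne hx]; exact hc x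
  -- the reset word `a'` : coordinate `j` reset to `τ j`
  obtain ⟨a', ha'⟩ : ∃ a' : Fin m → (Fin 2 →₀ ℕ), a' = Function.update a j (τ j) := ⟨_, rfl⟩
  have ha'A : a' ∈ Fintype.piFinset A := by rw [ha']; exact hupdA a haA j (τ j) (hτA j)
  have ha'j : a' j = τ j := by rw [ha', Function.update_self]
  have ha'ne : ∀ x, x ≠ j → a' x = a x := fun x hx => by rw [ha', Function.update_of_ne hx]
  -- an admissible demotion acts on a coordinate where `a'` carries the reference letter
  have hT1 : ∀ d : Fin m × (Fin 2 →₀ ℕ),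
      (d.1 = j ∨ (a d.1 = τ d.1 ∧ ¬ ∃ i' : Fin k, (f i' d.1).coeff (τ d.1) = 0 ∧
        ∀ j'', j'' ≠ d.1 → (f i' j'').coeff (Function.update a j (τ j) j'') ≠ 0)) → a' d.1 = τ d.1 := by
    rintro d (h | ⟨h, -⟩)
    · rw [h]; exact ha'j
    · have hne : d.1 ≠ j := by
        intro h'
        rw [h'] at h
        exact hj h
      rw [ha'ne _ hne]
      exact h
  -- ... and, off `j`, on a coordinate where `a` carries the reference letter and which no product kills exactly
  have hT2 : ∀ d : Fin m × (Fin 2 →₀ ℕ),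
      (d.1 = j ∨ (a d.1 = τ d.1 ∧ ¬ ∃ i' : Fin k, (f i' d.1).coeff (τ d.1) = 0 ∧
        ∀ j'', j'' ≠ d.1 → (f i' j'').coeff (Function.update a j (τ j) j'') ≠ 0)) → d.1 ≠ j →
      a d.1 = τ d.1 ∧ ∀ i' : Fin k, (f i' d.1).coeff (τ d.1) = 0 →
        ∃ j'', j'' ≠ d.1 ∧ (f i' j'').coeff (a' j'') = 0 := by
    rintro d (h | ⟨h, hP⟩) hne
    · exact absurd h hne
    · refine ⟨h, fun i' hz => ?_⟩
      by_contra hcon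
      push Not at hcon
      exact hP ⟨i', hz, fun j'' hj'' => by rw [← ha']; exact hcon j'' hj''⟩
  -- (★): `col f a` is the same combination of the columns of the words named by the demotions
  have hstar : QuasiPoly.col f a = Finsupp.linearCombination ℂ
      (fun d : Fin m × (Fin 2 →₀ ℕ) => QuasiPoly.col f (Function.update a' d.1 d.2)) l := by
    funext i'
    rw [Finsupp.linearCombination_apply, Finsupp.sum, Finset.sum_apply]
    simp only [Pi.smul_apply, smul_eq_mul]
    -- the product of the coefficients of the letters of `a` off `j`
    obtain ⟨R, hR⟩ : ∃ R : ℂ, R = ∏ x ∈ Finset.univ.erase j, (f i' x).coeff (a x) := ⟨_, rfl⟩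
    have hRa' : ∏ x ∈ Finset.univ.erase j, (f i' x).coeff (a' x) = R := by
      rw [hR]
      exact Finset.prod_congr rfl fun x hx => by rw [ha'ne x (Finset.ne_of_mem_erase hx)]
    have hcola : QuasiPoly.col f a i' = (f i' j).coeff (a j) * R := by rw [hR]; exact zcn_col_split f a j i'
    have hcola' : QuasiPoly.col f a' i' = (f i' j).coeff (τ j) * R := by
      rw [zcn_col_split f a' j i', ha'j, hRa']
    by_cases hz : (f i' j).coeff (τ j) = 0
    · -- product `i'` is dead at the reference letter of `j`: read the relation in the second block
      have hrel : ∑ d ∈ l.support, l d * (if (f i' d.1).coeff (τ d.1) = 0 then (f i' d.1).coeff d.2 else 0)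
          = (f i' j).coeff (a j) := by
        have h := congrFun hcomb ((1 : Fin 2), i')
        simpa [Finsupp.linearCombination_apply, Finsupp.sum, Finset.sum_apply, hz] using h
      rw [hcola, ← hrel, Finset.sum_mul]
      refine Finset.sum_congr rfl fun d hd => ?_
      obtain ⟨-, -, -, hcase⟩ := hlT (Finset.mem_coe.2 hd)
      rw [mul_assoc]
      congr 1
      rcases eq_or_ne d.1 j with hdj | hdj
      · -- a demotion on `j` itself names `update a j l'`
        rw [if_pos (by rw [hdj]; exact hz), zcn_col_update_split, hdj, hRa']
      · -- a demotion off `j`: both sides vanish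
        obtain ⟨had, -⟩ := hT2 d hcase hdj
        rw [zcn_col_eq_zero f _ j i' (by rw [Function.update_of_ne (Ne.symm hdj), ha'j]; exact hz)]
        split_ifs with hz'
        · have hR0 : R = 0 := by
            rw [hR]
            exact Finset.prod_eq_zero (Finset.mem_erase.2 ⟨hdj, Finset.mem_univ _⟩) (by rw [had]; exact hz')
          rw [hR0, mul_zero]
        · exact zero_mul R
    · -- product `i'` is alive at the reference letter of `j`: read the relation in the first block
      have hrel : ∑ d ∈ l.support, l d * ((f i' d.1).coeff d.2 / (f i' d.1).coeff (τ d.1))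
          = (f i' j).coeff (a j) / (f i' j).coeff (τ j) := by
        have h := congrFun hcomb ((0 : Fin 2), i')
        simpa [Finsupp.linearCombination_apply, Finsupp.sum, Finset.sum_apply] using h
      have h1 : QuasiPoly.col f a i' = (f i' j).coeff (a j) / (f i' j).coeff (τ j) * QuasiPoly.col f a' i' := by
        rw [hcola, hcola', div_mul_eq_mul_div, eq_div_iff hz]
        ring
      rw [h1, ← hrel, Finset.sum_mul]
      refine Finset.sum_congr rfl fun d hd => ?_
      obtain ⟨-, -, -, hcase⟩ := hlT (Finset.mem_coe.2 hd)
      have ha'd : a' d.1 = τ d.1 := hT1 d hcase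
      rw [mul_assoc]
      congr 1
      by_cases hz' : (f i' d.1).coeff (τ d.1) = 0
      · -- dead reference letter at `d.1 ≠ j`: the ratio is `0`, and the named word is dead in product `i'`
        have hdj : d.1 ≠ j := by
          intro h
          rw [h] at hz'
          exact hz hz'
        obtain ⟨-, hkill⟩ := hT2 d hcase hdj
        obtain ⟨j'', hj'', h0⟩ := hkill i' hz'
        rw [hz', div_zero, zero_mul,
          zcn_col_eq_zero f _ j'' i' (by rw [Function.update_of_ne hj'']; exact h0)]
      · -- alive reference letter: split both columns at `d.1`
        rw [zcn_col_update_split f a' d.1 d.2 i', zcn_col_split f a' d.1 i', ha'd, div_mul_eq_mul_div,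
          div_eq_iff hz']
        ring
  -- every named word is a strictly higher box word
  rw [hstar]
  have hmem' := (Finsupp.mem_span_image_iff_linearCombination ℂ
    (v := fun d : Fin m × (Fin 2 →₀ ℕ) => QuasiPoly.col f (Function.update a' d.1 d.2))).2 ⟨l, hl, rfl⟩
  refine Submodule.span_mono ?_ hmem'
  rintro _ ⟨d, ⟨hdA, -, hwt, hcase⟩, rfl⟩
  have ha'd : a' d.1 = τ d.1 := hT1 d hcase
  refine ⟨Function.update a' d.1 d.2, ⟨hupdA a' ha'A d.1 d.2 hdA, ?_⟩, rfl⟩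
  have h1 := TorusLogK.hgt_update ε lam a j (τ j)
  have h2 := TorusLogK.hgt_update ε lam a' d.1 d.2
  rw [← ha'] at h1
  rw [ha'd] at h2
  show ε * QuasiPoly.Xf a + lam * QuasiPoly.Yf a
    < ε * QuasiPoly.Xf (Function.update a' d.1 d.2) + lam * QuasiPoly.Yf (Function.update a' d.1 d.2)
  linarith

end Summit.ValiantsHypothesis.ValiantsHypothesis.Theorems.NewtonUnitEquationsDissociatedUniform
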